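import Summits.KontsevichZagierPeriods.KontsevichZagierPeriods.Theorems.FurushoPentagonStuffleInKZDefs

/-! drefute — instance checks of the LITERAL stubs of `Lines/cumulative-cube-lattice-paths.lean`
against the landed objects `Theorems/FurushoPentagonStuffleInKZDefs.lean`. -/

open Literature.NumberTheory.Transcendental
namespace Summit.KontsevichZagierPeriods.FurushoPentagon.StuffleInKZ

/-! ### stub_pathsCombinatorics: decidable instances -/

-- (ii) Nodup
example : (paths 2 2).Nodup := by
  simp only [paths_succ_succ, paths_zero_left, paths_succ_zero, List.map_cons, List.map_nil, List.cons_append, List.nil_append, List.replicate]; decide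
example : (paths 3 1).Nodup := by
  simp only [paths_succ_succ, paths_zero_left, paths_succ_zero, List.map_cons, List.map_nil, List.cons_append, List.nil_append, List.replicate]; decide
example : (paths 1 3).Nodup := by
  simp only [paths_succ_succ, paths_zero_left, paths_succ_zero, List.map_cons, List.map_nil, List.cons_append, List.nil_append, List.replicate]; decide
-- (iii) last-step Perm
example : (paths 2 2).Perm ((paths 1 2).map (· ++ [Step.X]) ++ ((paths 2 1).map (· ++ [Step.Y]) ++ (paths 1 1).map (· ++ [Step.D]))) := by
  simp only [paths_succ_succ, paths_zero_left, paths_succ_zero, List.map_cons, List.map_nil, List.cons_append, List.nil_append, List.replicate]; decide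
example : (paths 3 2).Perm ((paths 2 2).map (· ++ [Step.X]) ++ ((paths 3 1).map (· ++ [Step.Y]) ++ (paths 2 1).map (· ++ [Step.D]))) := by
  simp only [paths_succ_succ, paths_zero_left, paths_succ_zero, List.map_cons, List.map_nil, List.cons_append, List.nil_append, List.replicate]; decide
-- (iii) is NOT an ordered equality (so `Perm` is the right shape): already at (1,1)… it IS equal; at (2,1):
example : paths 2 1 ≠ ((paths 1 1).map (· ++ [Step.X]) ++ ((paths 2 0).map (· ++ [Step.Y]) ++ (paths 1 0).map (· ++ [Step.D]))) := by
  simp only [paths_succ_succ, paths_zero_left, paths_succ_zero, List.map_cons, List.map_nil, List.cons_append, List.nil_append, List.replicate]; decide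
-- (i) membership ↔ counts, instances
example : [Step.X, Step.D, Step.Y] ∈ paths 2 2 ∧ cx [Step.X, Step.D, Step.Y] = 2 ∧ cy [Step.X, Step.D, Step.Y] = 2 := by
  simp only [paths_succ_succ, paths_zero_left, paths_succ_zero, List.map_cons, List.map_nil, List.cons_append, List.nil_append, List.replicate]; decide
example : [Step.X, Step.X] ∉ paths 2 1 ∧ ¬ (cx [Step.X, Step.X] = 2 ∧ cy [Step.X, Step.X] = 1) := by
  simp only [paths_succ_succ, paths_zero_left, paths_succ_zero, List.map_cons, List.map_nil, List.cons_append, List.nil_append, List.replicate]; decide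
-- Delannoy counts 3, 5, 13, 63
example : (paths 1 1).length = 3 ∧ (paths 2 1).length = 5 ∧ (paths 2 2).length = 13 ∧ (paths 3 3).length = 63 := by
  simp only [paths_succ_succ, paths_zero_left, paths_succ_zero, List.map_cons, List.map_nil, List.cons_append, List.nil_append, List.replicate]; decide

/-! ### stub_termTransport part 1 and the engine, instances -/

example : MZV.weight (merge [Step.X, Step.D, Step.Y] [2, 1] [3, 1]) = MZV.weight [2, 1] + MZV.weight [3, 1] := by decide
example : merge [Step.Y, Step.D, Step.X] [2, 1] [3, 1] = [3, 3, 1] := by decide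
-- engine with a zero entry in `s` (no positivity hypothesis in the stub): both sides agree (symbolically)
example (x u v : ℝ) : interleave [Step.D, Step.X] [0, 1] [2] [x] [u, v] = [u, v, x] ∧
    cubeKernel (merge [Step.D, Step.X] [0, 1] [2]) [u, v, x] = pathKernel [0, 1] [2] [Step.D, Step.X] [x] [u, v] := by
  refine ⟨rfl, ?_⟩
  simp [cubeKernel, pathKernel, nodeProd, cx, cy, merge, List.take, Finset.prod_range_succ]
  ring
-- engine, generic instance p = X D Y, s = [1,2], t = [1,1]
example (a b c u v : ℝ) : interleave [Step.X, Step.D, Step.Y] [1, 2] [1, 1] [a, b, c] [u, v] = [a, b, c, u, v] ∧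
    cubeKernel (merge [Step.X, Step.D, Step.Y] [1, 2] [1, 1]) [a, b, c, u, v]
      = pathKernel [1, 2] [1, 1] [Step.X, Step.D, Step.Y] [a, b, c] [u, v] := by
  refine ⟨rfl, ?_⟩
  simp [cubeKernel, pathKernel, nodeProd, cx, cy, merge, List.take, Finset.prod_range_succ, mul_assoc]
example (a b c u v : ℝ) : interleave [Step.Y, Step.X, Step.D] [1, 2] [1, 1] [a, b, c] [u, v] = [u, a, b, c, v] ∧
    cubeKernel (merge [Step.Y, Step.X, Step.D] [1, 2] [1, 1]) [u, a, b, c, v]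
      = pathKernel [1, 2] [1, 1] [Step.Y, Step.X, Step.D] [a, b, c] [u, v] := by
  refine ⟨rfl, ?_⟩
  simp [cubeKernel, pathKernel, nodeProd, cx, cy, merge, List.take, Finset.prod_range_succ]
  ring

/-! ### stub_kernelStuffle: exact instances at rational points of the open cube -/

-- s = t = [1] at xs = [1/2], ys = [1/3]: both sides are 3
example : cubeKernel [1] [(1:ℝ)/2] * cubeKernel [1] [1/3] = 3 := by
  simp [cubeKernel]; norm_num
example : ((paths 1 1).map fun p => pathKernel [1] [1] p [(1:ℝ)/2] [1/3]).sum = 3 := by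
  simp [paths_succ_succ, pathKernel, nodeProd, cx, cy, Finset.prod_range_succ]; norm_num
-- s = [2], t = [1,1] at xs = [1/2,1/3], ys = [1/5,1/7]
example : cubeKernel [2] [(1:ℝ)/2, 1/3] * cubeKernel [1, 1] [1/5, 1/7]
    = ((paths 1 2).map fun p => pathKernel [2] [1, 1] p [(1:ℝ)/2, 1/3] [1/5, 1/7]).sum := by
  simp [paths_succ_succ, cubeKernel, pathKernel, nodeProd, cx, cy, Finset.prod_range_succ]; norm_num

/-! ### mutations of stub_kernelStuffle (its hypotheses are load-bearing) -/

-- open interval: at the closed corner xs = [1], ys = [1/2] the identity FAILS (junk `1/0 = 0`): 0 ≠ 4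
example : cubeKernel [1] [(1:ℝ)] * cubeKernel [1] [1/2] = 0 ∧
    ((paths 1 1).map fun p => pathKernel [1] [1] p [(1:ℝ)] [1/2]).sum = 4 := by
  constructor
  · simp [cubeKernel]
  · simp [paths_succ_succ, pathKernel, nodeProd, cx, cy, Finset.prod_range_succ]; norm_num
-- entries ≥ 1: s = [0], t = [1], xs = [], ys = [1/2]: 0 ≠ 4
example : cubeKernel [0] ([] : List ℝ) * cubeKernel [1] [1/2] = 0 ∧
    ((paths 1 1).map fun p => pathKernel [0] [1] p ([] : List ℝ) [1/2]).sum = 4 := by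
  constructor
  · simp [cubeKernel]
  · simp [paths_succ_succ, pathKernel, nodeProd, cx, cy, Finset.prod_range_succ]; norm_num
-- exact length: with xs too SHORT but non-empty the identity still holds (s = [2], xs = [1/2]); with xs = [] it fails
example : cubeKernel [2] [(1:ℝ)/2] * cubeKernel [1] [1/3]
    = ((paths 1 1).map fun p => pathKernel [2] [1] p [(1:ℝ)/2] [1/3]).sum := by
  simp [paths_succ_succ, cubeKernel, pathKernel, nodeProd, cx, cy, Finset.prod_range_succ]; norm_num
example : cubeKernel [1] ([] : List ℝ) * cubeKernel [1] [1/2] = 0 ∧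
    ((paths 1 1).map fun p => pathKernel [1] [1] p ([] : List ℝ) [1/2]).sum = 4 := by
  constructor
  · simp [cubeKernel]
  · simp [paths_succ_succ, pathKernel, nodeProd, cx, cy, Finset.prod_range_succ]; norm_num

/-! ### stub_chartCalculus: the degenerate dimension `w = 0` and `w = 1` are fine -/

example : chart 0 '' openCube 0 = KZ.openOrderedSimplex 0 := by
  have h1 : openCube 0 = Set.univ := by ext x; simp [openCube]
  have h2 : KZ.openOrderedSimplex 0 = Set.univ := by
    ext t; simp [KZ.openOrderedSimplex, StrictAnti]
  rw [h1, h2, Set.image_univ, Set.range_eq_univ]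
  intro t; exact ⟨t, Subsingleton.elim _ _⟩

example (x : Fin 1 → ℝ) : chart 1 x 0 = x 0 := by
  simp [chart, Finset.filter_true_of_mem, Fin.eq_zero]

end Summit.KontsevichZagierPeriods.FurushoPentagon.StuffleInKZ
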